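import Summits.HodgeConjecture.HodgeConjecture.Theorems.PadicSemiregularLiftFormalLiftingFromClassLiftingOfHu
import Literature.AlgebraicGeometry.Motives.GrothendieckExistenceWitt
import Literature.AlgebraicGeometry.Modules.VectorBundleFiniteLocallyFree
import Literature.AlgebraicGeometry.Crystalline.BlochEsnaultKerzLifting

/-!
# Route AnchorTransport — crux `VariationalHodge` (stmt-HodgeConjecture-1076), line `padic-disc-transport`:
# the JUNCTION at STUB P with route `PadicSemiregularLift` — its engine P1a + P3a proves the bet for
# pro-classes with a (⋆)-bottom bundle

HONEST FRAMING: research route conditional on HC_CM; not a corollary; Q11.4-sentence-2 already refuted in dim ≥ 3.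
Helper file on the crux item (nothing here closes it; no definition, no named fact, no `sorry`;
`HC_CM` does not occur). Cell `pub-hodge-ring2`, binder seat `ring2-b03` (gen 39), BINDER-OWNERS row b03.

The registered skeleton `Cruxes/VariationalHodge/Lines/padic_disc_transport.lean` describes its bet, STUB P
(`PadicDiscTransport.PadicImageAlgebraization`: every rational pro-class
`ξ̂ ∈ (lim_n K₀(𝒴 ⊗ W/p^{n+1})) ⊗ ℚ` on a smooth proper model `𝒴/W(κ)` has `ξ̂|_{Y_κ}` the restriction of an
algebraic class `η ∈ K₀(𝒴)_ℚ` — `PadicDiscTransport.ProClassAlgebraizes`, spelled out VERBATIM below, the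
skeleton's local `def`s not being importable under `Theorems/`), as having a "junction with route
`PadicSemiregularLift`, whose engine `FormalLiftingFromClassLifting` + `FormalVectorBundlesAlgebraize` is one
way to prove STUB P for semiregular seeds". This file is that sentence as kernel theorems, against the two
route items BY NAME:

* P1a = `Theses.PadicSemiregularLift.FormalLiftingFromClassLifting` (stmt-HodgeConjecture-13825): on a smooth
  proper `W(κ)`-model, projective over `W`, of relative dimension `d` with `d + 6 < p` and torsion-free
  Hodge cohomology (as typed there), a finite locally free `E₁` on the special fibre satisfying (⋆)
  CLASS-LIFTS-IMPLY-OBJECT-LIFTS lifts FORMALLY as soon as its class `[E₁]_ℚ` is the bottom class of a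
  rational pro-class (`∃ ξ̂, ξ̂|_{Y_κ} = [E₁]_ℚ`);
* P3a = `Theses.PadicSemiregularLift.FormalVectorBundlesAlgebraize` (stmt-HodgeConjecture-14106;
  Grothendieck's existence theorem, EGA III₁ 5.1.4): formal lifts algebraize (`LiftsFormally ⟹ LiftsTo`).

Consequences typed here (all with the conclusion of STUB P verbatim):

* `proClassAlgebraizes_of_padicSemiregularLiftEngine` — **P1a ∧ P3a ⟹ STUB P's conclusion for every
  pro-class `ξ̂` whose bottom class `ξ̂|_{Y_κ}` is `[E₁]_ℚ` with `E₁` satisfying (⋆)**, on the models of P1a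
  (the algebraization `F` of the formal lift has `[F]|_{Y_κ} = [E₁]_ℚ = ξ̂|_{Y_κ}`);
* `proClassAlgebraizes_of_classLifting_of_grothendieckExistence` — the same with P3a replaced by the
  Literature named fact `Motives.GrothendieckExistence_vectorBundle_witt` (Görtz–Wedhorn II Thm. 24.94 /
  Prop. 24.95; NOT discharged);
* `proClassAlgebraizes_of_hu_of_hodgeDeRhamDegeneration` — the same with P1a replaced by its two
  antecedents in the route (`HuInfinitesimalKZero`, `HodgeDeRhamDegeneration`), through the CLOSED glue
  `formalLiftingFromClassLiftingOfHu_proof` (item stmt-HodgeConjecture-15976, proved);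
* `padicImageAlgebraization_star_of_padicSemiregularLiftEngine` — STUB P's quantifier block VERBATIM with
  the extra binders (P1a's model hypotheses; a (⋆)-bundle `E₁` with `ξ̂|_{Y_κ} = [E₁]_ℚ`), `p₀ = d + 7`,
  derived from P1a ∧ P3a: the exact shape in which route `PadicSemiregularLift` serves the bet of route
  `AnchorTransport`'s line.

What is NOT claimed: P itself; P1a, P3a, Hu's claims, Deligne's degeneration or Grothendieck existence
(all hypotheses / antecedents here); anything about `VariationalHodge` or the Hodge conjecture.

References: [BlochEsnaultKerz2014pAdic] §1 ((1.3), Conj. 1.2, Thm. 1.3, Remark (iii)), Rem. 35 (2);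
[AntieauMathewMorrowNikolaus2022] Conj. 1.3, Question 1.4; [GortzWedhorn2023] Thm. 24.94, Prop. 24.95;
[EGAIII1] Thm. 5.1.4; [Hu2025TruncatedWitt] Thm. 1.2, Cor. 10.5 (i); [Deligne1968] Thm. 5.5 (ii).
-/

noncomputable section

-- every declaration of this problem lives in `Summit.HodgeConjecture.HodgeConjecture.…` (summit = sub-problem)
set_option linter.dupNamespace false

open CategoryTheory CategoryTheory.Limits AlgebraicGeometry
open scoped TensorProduct
open Literature.AlgebraicGeometry Literature.AlgebraicGeometry.Motives
open Literature.AlgebraicGeometry.KTheory Literature.AlgebraicGeometry.Crystalline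
open Summit.HodgeConjecture.HodgeConjecture.Theses.PadicSemiregularLift
  (FormalLiftingFromClassLifting FormalVectorBundlesAlgebraize HuInfinitesimalKZero HodgeDeRhamDegeneration)

namespace Summit.HodgeConjecture.HodgeConjecture.Theorems

variable {p : ℕ} [Fact p.Prime] {κ : Type} [Field κ] [CharP κ p] [PerfectRing κ p]
  (𝒴 : SchemeOver (WittVector p κ))

/-! ## §1 Bottom classes of bundles that lift algebraically -/

omit [PerfectRing κ p] in
/-- **A bundle on `Y_κ` that lifts to `𝒴` gives STUB P's conclusion for every pro-class with bottom
class `[E₁]_ℚ`**: if `E₁ ≅ F|_{Y_κ}` for a vector bundle `F` on `𝒴` and `ξ̂|_{Y_κ} = [E₁]_ℚ`, then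
`η := [F]_ℚ` algebraizes `ξ̂` (`[F]|_{Y_κ} = [F|_{Y_κ}] = [E₁]`). [cite: Fulton1998, §15.1]
[cite: BlochEsnaultKerz2014pAdic, §1] -/
theorem proClassAlgebraizes_of_liftsTo_of_specialFibre_eq
    {E₁ : (WittScheme.specialFibre 𝒴).left.Modules} (hE₁ : IsFiniteLocallyFree E₁)
    (hlift : WittScheme.LiftsTo 𝒴 E₁)
    (ξ : ContinuousKZeroRat (Ideal.span {(p : WittVector p κ)}) 𝒴)
    (hξ : KZeroRat.map (specialFibreToTower 𝒴)
      (ContinuousKZeroRat.specialFibre (Ideal.span {(p : WittVector p κ)}) 𝒴 ξ) = KZeroRat.of E₁ hE₁) :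
    ∃ η : KZeroRat 𝒴.left,
        KZeroRat.map (WittScheme.specialFibreι 𝒴) η =
          KZeroRat.map (specialFibreToTower 𝒴)
            (ContinuousKZeroRat.specialFibre (Ideal.span {(p : WittVector p κ)}) 𝒴 ξ) := by
  obtain ⟨F, hF, ⟨e⟩⟩ := hlift
  refine ⟨KZeroRat.of F (Modules.isFiniteLocallyFree_of_isVectorBundle hF), ?_⟩
  rw [hξ, KZeroRat.map_of]
  change (1 : ℚ) ⊗ₜ[ℤ] KZero.of _ _ = (1 : ℚ) ⊗ₜ[ℤ] KZero.of _ _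
  rw [KZero.of_iso e _ hE₁]

/-! ## §2 The junction: P1a ∧ P3a ⟹ STUB P on pro-classes with a (⋆)-bottom bundle -/

/-- **Route `PadicSemiregularLift`'s engine proves STUB P for pro-classes with a (⋆)-bottom bundle.**
On a smooth proper `W(κ)`-model `𝒴`, projective over `W`, of relative dimension `d`, `d + 6 < p`, with
the torsion-freeness hypotheses of P1a: if the bottom class `ξ̂|_{Y_κ}` of a rational pro-class `ξ̂` is the
class of a finite locally free `E₁` satisfying (⋆) CLASS-LIFTS-IMPLY-OBJECT-LIFTS (P1a's hypothesis,
verbatim), then P1a (`FormalLiftingFromClassLifting`, fed with `ξ̂` itself as the rational pro-class lift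
of `[E₁]`) makes `E₁` lift formally, P3a (`FormalVectorBundlesAlgebraize`) algebraizes the formal lift to
`F` on `𝒴`, and `η = [F]_ℚ` has `η|_{Y_κ} = ξ̂|_{Y_κ}` — the conclusion of STUB P (`ProClassAlgebraizes`,
verbatim). [cite: BlochEsnaultKerz2014pAdic, Thm. 1.3 and §1 (1.3)] [cite: EGAIII1, Thm 5.1.4] -/
theorem proClassAlgebraizes_of_padicSemiregularLiftEngine
    (hP1a : FormalLiftingFromClassLifting) (hP3a : FormalVectorBundlesAlgebraize) {d : ℕ}
    (h𝒴 : WittScheme.IsSmoothProperModel d 𝒴) (hproj : IsProjectiveOverRing 𝒴) (hp : d + 6 < p)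
    (hO : ∀ (b : ℕ) (x : structureSheafCohomology 𝒴.left b), (p : ℤ) • x = 0 → x = 0)
    (hΩ : ∀ (b : ℕ) (x : hodgeCohomologyOne 𝒴 b), (p : ℤ) • x = 0 → x = 0)
    (hd : d ≤ 3 ∨
      Nonempty (cotangentSheaf 𝒴 ≅ SheafOfModules.free (R := 𝒴.left.ringCatSheaf) (Fin d)))
    {E₁ : (WittScheme.specialFibre 𝒴).left.Modules} (hE₁ : IsFiniteLocallyFree E₁)
    (hstar : ∀ (n : ℕ) (F : (WittScheme.thickening 𝒴 (n + 1)).left.Modules)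
      (hF : IsFiniteLocallyFree F),
      Nonempty ((Scheme.Modules.pullback (WittScheme.specialFibreToThickening 𝒴 n)).obj F ≅ E₁) →
      (∃ y : KZero (WittScheme.thickening 𝒴 (n + 2)).left,
        KZero.map (WittScheme.thickeningMap 𝒴 (Nat.le_succ (n + 1))) y = KZero.of F hF) →
      ∃ F' : (WittScheme.thickening 𝒴 (n + 2)).left.Modules, IsFiniteLocallyFree F' ∧
        Nonempty ((Scheme.Modules.pullback
          (WittScheme.thickeningMap 𝒴 (Nat.le_succ (n + 1)))).obj F' ≅ F))
    (ξ : ContinuousKZeroRat (Ideal.span {(p : WittVector p κ)}) 𝒴)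
    (hξ : KZeroRat.map (specialFibreToTower 𝒴)
      (ContinuousKZeroRat.specialFibre (Ideal.span {(p : WittVector p κ)}) 𝒴 ξ) = KZeroRat.of E₁ hE₁) :
    ∃ η : KZeroRat 𝒴.left,
        KZeroRat.map (WittScheme.specialFibreι 𝒴) η =
          KZeroRat.map (specialFibreToTower 𝒴)
            (ContinuousKZeroRat.specialFibre (Ideal.span {(p : WittVector p κ)}) 𝒴 ξ) :=
  proClassAlgebraizes_of_liftsTo_of_specialFibre_eq 𝒴 hE₁
    (hP3a p κ d 𝒴 h𝒴 E₁ (hP1a p κ d 𝒴 h𝒴 hproj hp hO hΩ hd E₁ hE₁ hstar ⟨ξ, hξ⟩)) ξ hξ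

/-- **The same with P3a replaced by the Literature named fact** `GrothendieckExistence_vectorBundle_witt`
(Görtz–Wedhorn II Thm. 24.94 / Prop. 24.95 = EGA III₁ 5.1.4; hypothesis `hGE`, NOT discharged; only
properness of `𝒴` is used by it). [cite: GortzWedhorn2023, Thm 24.94 and Prop 24.95]
[cite: BlochEsnaultKerz2014pAdic, Thm. 1.3] -/
theorem proClassAlgebraizes_of_classLifting_of_grothendieckExistence
    (hP1a : FormalLiftingFromClassLifting) (hGE : GrothendieckExistence_vectorBundle_witt.{0}) {d : ℕ}
    (h𝒴 : WittScheme.IsSmoothProperModel d 𝒴) (hproj : IsProjectiveOverRing 𝒴) (hp : d + 6 < p)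
    (hO : ∀ (b : ℕ) (x : structureSheafCohomology 𝒴.left b), (p : ℤ) • x = 0 → x = 0)
    (hΩ : ∀ (b : ℕ) (x : hodgeCohomologyOne 𝒴 b), (p : ℤ) • x = 0 → x = 0)
    (hd : d ≤ 3 ∨
      Nonempty (cotangentSheaf 𝒴 ≅ SheafOfModules.free (R := 𝒴.left.ringCatSheaf) (Fin d)))
    {E₁ : (WittScheme.specialFibre 𝒴).left.Modules} (hE₁ : IsFiniteLocallyFree E₁)
    (hstar : ∀ (n : ℕ) (F : (WittScheme.thickening 𝒴 (n + 1)).left.Modules)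
      (hF : IsFiniteLocallyFree F),
      Nonempty ((Scheme.Modules.pullback (WittScheme.specialFibreToThickening 𝒴 n)).obj F ≅ E₁) →
      (∃ y : KZero (WittScheme.thickening 𝒴 (n + 2)).left,
        KZero.map (WittScheme.thickeningMap 𝒴 (Nat.le_succ (n + 1))) y = KZero.of F hF) →
      ∃ F' : (WittScheme.thickening 𝒴 (n + 2)).left.Modules, IsFiniteLocallyFree F' ∧
        Nonempty ((Scheme.Modules.pullback
          (WittScheme.thickeningMap 𝒴 (Nat.le_succ (n + 1)))).obj F' ≅ F))
    (ξ : ContinuousKZeroRat (Ideal.span {(p : WittVector p κ)}) 𝒴)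
    (hξ : KZeroRat.map (specialFibreToTower 𝒴)
      (ContinuousKZeroRat.specialFibre (Ideal.span {(p : WittVector p κ)}) 𝒴 ξ) = KZeroRat.of E₁ hE₁) :
    ∃ η : KZeroRat 𝒴.left,
        KZeroRat.map (WittScheme.specialFibreι 𝒴) η =
          KZeroRat.map (specialFibreToTower 𝒴)
            (ContinuousKZeroRat.specialFibre (Ideal.span {(p : WittVector p κ)}) 𝒴 ξ) :=
  proClassAlgebraizes_of_liftsTo_of_specialFibre_eq 𝒴 hE₁
    (hGE.liftsTo_of_liftsFormally h𝒴.isProper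
      (hP1a p κ d 𝒴 h𝒴 hproj hp hO hΩ hd E₁ hE₁ hstar ⟨ξ, hξ⟩)) ξ hξ

/-- **The same from the ANTECEDENTS of P1a in the route**: Hu's two `K₀`-claims (item
`HuInfinitesimalKZero`) and Deligne's degeneration of Hodge–de Rham modulo torsion (item
`HodgeDeRhamDegeneration`) give P1a by the CLOSED glue `formalLiftingFromClassLiftingOfHu_proof` (item
stmt-HodgeConjecture-15976), whence, with P3a, STUB P's conclusion for pro-classes with a (⋆)-bottom
bundle. [cite: Hu2025TruncatedWitt, Thm. 1.2 and Cor. 10.5 (i)] [cite: Deligne1968, Thm. 5.5 (ii)]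
[cite: BlochEsnaultKerz2014pAdic, Thm. 1.3] -/
theorem proClassAlgebraizes_of_hu_of_hodgeDeRhamDegeneration
    (hHu : HuInfinitesimalKZero) (hdeg : HodgeDeRhamDegeneration) (hP3a : FormalVectorBundlesAlgebraize)
    {d : ℕ} (h𝒴 : WittScheme.IsSmoothProperModel d 𝒴) (hproj : IsProjectiveOverRing 𝒴) (hp : d + 6 < p)
    (hO : ∀ (b : ℕ) (x : structureSheafCohomology 𝒴.left b), (p : ℤ) • x = 0 → x = 0)
    (hΩ : ∀ (b : ℕ) (x : hodgeCohomologyOne 𝒴 b), (p : ℤ) • x = 0 → x = 0)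
    (hd : d ≤ 3 ∨
      Nonempty (cotangentSheaf 𝒴 ≅ SheafOfModules.free (R := 𝒴.left.ringCatSheaf) (Fin d)))
    {E₁ : (WittScheme.specialFibre 𝒴).left.Modules} (hE₁ : IsFiniteLocallyFree E₁)
    (hstar : ∀ (n : ℕ) (F : (WittScheme.thickening 𝒴 (n + 1)).left.Modules)
      (hF : IsFiniteLocallyFree F),
      Nonempty ((Scheme.Modules.pullback (WittScheme.specialFibreToThickening 𝒴 n)).obj F ≅ E₁) →
      (∃ y : KZero (WittScheme.thickening 𝒴 (n + 2)).left,
        KZero.map (WittScheme.thickeningMap 𝒴 (Nat.le_succ (n + 1))) y = KZero.of F hF) →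
      ∃ F' : (WittScheme.thickening 𝒴 (n + 2)).left.Modules, IsFiniteLocallyFree F' ∧
        Nonempty ((Scheme.Modules.pullback
          (WittScheme.thickeningMap 𝒴 (Nat.le_succ (n + 1)))).obj F' ≅ F))
    (ξ : ContinuousKZeroRat (Ideal.span {(p : WittVector p κ)}) 𝒴)
    (hξ : KZeroRat.map (specialFibreToTower 𝒴)
      (ContinuousKZeroRat.specialFibre (Ideal.span {(p : WittVector p κ)}) 𝒴 ξ) = KZeroRat.of E₁ hE₁) :
    ∃ η : KZeroRat 𝒴.left,
        KZeroRat.map (WittScheme.specialFibreι 𝒴) η =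
          KZeroRat.map (specialFibreToTower 𝒴)
            (ContinuousKZeroRat.specialFibre (Ideal.span {(p : WittVector p κ)}) 𝒴 ξ) :=
  proClassAlgebraizes_of_padicSemiregularLiftEngine 𝒴 (formalLiftingFromClassLiftingOfHu_proof hHu hdeg)
    hP3a h𝒴 hproj hp hO hΩ hd hE₁ hstar ξ hξ

/-! ## §3 STUB P's quantifier block with the junction binders -/

/-- **STUB P (quantifier block verbatim, `p₀ = d + 7`) on P1a-models, for pro-classes with a
(⋆)-bottom bundle, from route `PadicSemiregularLift`'s items P1a ∧ P3a** — the typed junction of the two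
`p`-adic routes at the bet: the extra binders are exactly P1a's model hypotheses (projective over `W`,
torsion-free Hodge cohomology, `d ≤ 3 ∨ Ω¹` free) and the (⋆)-bundle `E₁` with `ξ̂|_{Y_κ} = [E₁]_ℚ`; the
bound `p₀ = d + 7` realises P1a's `d + 6 < p`. What remains of the bet outside this junction: models
failing P1a's hypotheses, and pro-classes whose bottom class is not (a `ℚ`-combination of classes of)
(⋆)-bundles. [cite: BlochEsnaultKerz2014pAdic, Conj. 1.2 and Thm. 1.3]
[cite: AntieauMathewMorrowNikolaus2022, Conj. 1.3] [cite: EGAIII1, Thm 5.1.4] -/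
theorem padicImageAlgebraization_star_of_padicSemiregularLiftEngine
    (hP1a : FormalLiftingFromClassLifting) (hP3a : FormalVectorBundlesAlgebraize) :
    ∀ d : ℕ, ∃ p₀ : ℕ, ∀ (p : ℕ) [Fact p.Prime], p₀ ≤ p →
    ∀ (κ : Type) [Field κ] [CharP κ p] [PerfectRing κ p] [IsAlgClosed κ] [Algebra (ZMod p) κ],
    Algebra.IsAlgebraic (ZMod p) κ →
    ∀ (𝒴 : SchemeOver (WittVector p κ)), WittScheme.IsSmoothProperModel d 𝒴 →
    -- extra binders: P1a's model hypotheses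
    IsProjectiveOverRing 𝒴 →
    (∀ (b : ℕ) (x : structureSheafCohomology 𝒴.left b), (p : ℤ) • x = 0 → x = 0) →
    (∀ (b : ℕ) (x : hodgeCohomologyOne 𝒴 b), (p : ℤ) • x = 0 → x = 0) →
    (d ≤ 3 ∨ Nonempty (cotangentSheaf 𝒴 ≅ SheafOfModules.free (R := 𝒴.left.ringCatSheaf) (Fin d))) →
    ∀ ξ : ContinuousKZeroRat (Ideal.span {(p : WittVector p κ)}) 𝒴,
    -- extra binder: a (⋆)-bottom bundle
    (∃ (E₁ : (WittScheme.specialFibre 𝒴).left.Modules) (hE₁ : IsFiniteLocallyFree E₁),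
      (∀ (n : ℕ) (F : (WittScheme.thickening 𝒴 (n + 1)).left.Modules) (hF : IsFiniteLocallyFree F),
        Nonempty ((Scheme.Modules.pullback (WittScheme.specialFibreToThickening 𝒴 n)).obj F ≅ E₁) →
        (∃ y : KZero (WittScheme.thickening 𝒴 (n + 2)).left,
          KZero.map (WittScheme.thickeningMap 𝒴 (Nat.le_succ (n + 1))) y = KZero.of F hF) →
        ∃ F' : (WittScheme.thickening 𝒴 (n + 2)).left.Modules, IsFiniteLocallyFree F' ∧
          Nonempty ((Scheme.Modules.pullback
            (WittScheme.thickeningMap 𝒴 (Nat.le_succ (n + 1)))).obj F' ≅ F)) ∧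
      KZeroRat.map (specialFibreToTower 𝒴)
        (ContinuousKZeroRat.specialFibre (Ideal.span {(p : WittVector p κ)}) 𝒴 ξ) = KZeroRat.of E₁ hE₁) →
    ∃ η : KZeroRat 𝒴.left,
      KZeroRat.map (WittScheme.specialFibreι 𝒴) η =
        KZeroRat.map (specialFibreToTower 𝒴)
          (ContinuousKZeroRat.specialFibre (Ideal.span {(p : WittVector p κ)}) 𝒴 ξ) := by
  intro d
  refine ⟨d + 7, ?_⟩
  intro p _ hp κ _ _ _ _ _ _ 𝒴 h𝒴 hproj hO hΩ hd ξ hξ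
  obtain ⟨E₁, hE₁, hstar, hξ⟩ := hξ
  exact proClassAlgebraizes_of_padicSemiregularLiftEngine 𝒴 hP1a hP3a h𝒴 hproj (by omega) hO hΩ hd hE₁
    hstar ξ hξ

end Summit.HodgeConjecture.HodgeConjecture.Theorems

end
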